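import Mathlib
import Summits.Ventures.PercRepro2.HCov
import Summits.Ventures.PercRepro2.A3RootEdge
import Summits.Ventures.PercRepro2.RootEdgeBern
import Summits.Ventures.PercRepro2.HCovPlusQuartic
import Summits.Ventures.PercRepro2.QuarticRootCross

/-!
# THE MIDDLE SLACK COEFFICIENT `slackBm` AT A ROOT EDGE IN CLOSED-PIN MASSES, AND `Q₀·H2`
DECOMPOSED (blind cell PercRepro2, p5 g18; `proofs/P5-OEDGE.md` §24 (I2), (I5))

At a root edge `e = {a₁, a₃}` the `b`-masses of the open pin glue onto the closed one exactly as the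
`o`-masses did in `QuarticRootCross`: `P₁(Q, bH) = P₀(PD, bH) + P₀(T′, bH)` (**`prob_one_Q_bH_root_split`**)
and `P₁(Q, bL) = P₀(PD, bL) + P₀(PD, b ↔ a₃) + P₀(T′, bL)` (**`prob_one_Q_bL_root_split`**); with
`PD`, `T` null and `T′ = Q` at the open pin, the polarised slack collapses onto the predecessor's
signed piece `df = Q₀·(P₁(Q,bL) − P₁(Q,bH)) − Q₁·(P₀(Q,bL) − P₀(Q,bH)) ≥ 0` (`A3RootEdge.dfc_nonneg`):

  **`slackBm_root_decomp`**: `slackBm = 2·df − 2·Q₁·P₀(PD, b ↔ a₃) + 2·δ_bH`,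
  `δ_bH = P₀(T′)·P₀(PD, bH) − D₀·P₀(T′, bH) ≥ 0` (`T'oH_mul_D_le` with `o := b`).

Hence `slackBm ≤ 2·df + 2·δ_bH` (**`slackBm_root_le`**) and the census-true `0 ≤ slackBm` of the
root-edge face is exactly «opening the root edge raises `E_ν[σ_b]` by at least
`Q₁·P(PD, b ↔ a₃) − δ_bH`» (**`slackBm_nonneg_root_iff`**). Finally (**`Q0_mul_H2_root`**)
`Q₀·H2 = 2·D₀·Q₀²·g₁ + Q₁²·Gc₀ + df·dg + Q₀·c·slackBm` with `g₁, df, dg ≥ 0` the three signed pieces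
of `A3RootEdge` and `c = covUm ≥ −δ_oH` (`QuarticRootCrossOL`). No sign of `slackBm` or of `H2` is
claimed; both are census-true (§24) and neither is a theorem.
-/

namespace Summit.Ventures.PercRepro2

open UnionCluster CovForm CovForm.EdgeLine CovForm.RootEdge HCovPlusQuartic

namespace QuarticRootCross

section Slack

variable {V : Type*} {E : Type*} [Fintype V] [DecidableEq V] [Fintype E] [DecidableEq E]
  {R : Type*} [Field R] [LinearOrder R] [IsStrictOrderedRing R]

variable {ends : E → Sym2 V} {e : E} {a₁ a₃ : V}

omit [Fintype V] [LinearOrder R] [IsStrictOrderedRing R] in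
/-- **`P₁(Q, bH) = P₀(PD, bH) + P₀(T′, bH)`** at a root edge (`prob_one_Q_conn` and the `PD ⊔ T′` split). -/
theorem prob_one_Q_bH_root_split (p : E → R) (hends : ends e = s(a₁, a₃)) (a₂ b : V) :
    prob (Function.update p e 1) (avoidAll ends a₂ {a₁} ∩ connEvent ends a₂ b) =
      prob (Function.update p e 0) (PDEvent ends a₁ a₂ a₃ ∩ connEvent ends a₂ b) +
        prob (Function.update p e 0) (TEvent ends a₂ a₁ a₃ ∩ connEvent ends a₂ b) := by
  rw [prob_one_Q_conn p hends a₂ b]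
  have h2 : prob (Function.update p e 0) (avoidAll ends a₂ {a₁} ∩ connEvent ends a₂ b ∩
      (connEvent ends a₂ a₃)ᶜ) =
      prob (Function.update p e 0)
        (avoidAll ends a₂ {a₁} ∩ ((connEvent ends a₂ a₃)ᶜ ∩ connEvent ends a₂ b)) := by
    congr 1; ext ω; simp only [Set.mem_inter_iff]; tauto
  rw [h2, prob_Q_not_a3_C2_split (Function.update p e 0) a₂]

omit [Fintype V] [LinearOrder R] [IsStrictOrderedRing R] in
/-- **`P₁(Q, bL) = P₀(PD, bL) + P₀(PD, b ↔ a₃) + P₀(T′, bL)`** at a root edge. -/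
theorem prob_one_Q_bL_root_split (p : E → R) (hends : ends e = s(a₁, a₃)) (a₂ b : V) :
    prob (Function.update p e 1) (avoidAll ends a₂ {a₁} ∩ connEvent ends a₁ b) =
      prob (Function.update p e 0) (PDEvent ends a₁ a₂ a₃ ∩ connEvent ends a₁ b) +
        prob (Function.update p e 0) (PDEvent ends a₁ a₂ a₃ ∩ connEvent ends a₃ b) +
        prob (Function.update p e 0) (TEvent ends a₂ a₁ a₃ ∩ connEvent ends a₁ b) := by
  rw [prob_one_Q_conn_a1 p hends a₂ b, prob_Q_not_a3_C2_split (Function.update p e 0) a₂,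
    prob_split_conn_a1_a3]

omit [Fintype V] in
/-- **`slackBm` at a root edge in closed-pin masses**:
`slackBm = 2·df − 2·Q₁·P₀(PD, b ↔ a₃) + 2·[P₀(T′)·P₀(PD, bH) − D₀·P₀(T′, bH)]`, with
`df = Q₀·(P₁(Q,bL) − P₁(Q,bH)) − Q₁·(P₀(Q,bL) − P₀(Q,bH))` the signed piece of `A3RootEdge`. -/
theorem slackBm_root_decomp (p : E → R) (hends : ends e = s(a₁, a₃)) (a₂ b : V) :
    slackBm p ends a₁ a₂ a₃ b e =
      2 * (prob (Function.update p e 0) (avoidAll ends a₂ {a₁}) *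
            (prob (Function.update p e 1) (avoidAll ends a₂ {a₁} ∩ connEvent ends a₁ b) -
              prob (Function.update p e 1) (avoidAll ends a₂ {a₁} ∩ connEvent ends a₂ b)) -
          prob (Function.update p e 1) (avoidAll ends a₂ {a₁}) *
            (prob (Function.update p e 0) (avoidAll ends a₂ {a₁} ∩ connEvent ends a₁ b) -
              prob (Function.update p e 0) (avoidAll ends a₂ {a₁} ∩ connEvent ends a₂ b))) -
        2 * prob (Function.update p e 1) (avoidAll ends a₂ {a₁}) *
          prob (Function.update p e 0) (PDEvent ends a₁ a₂ a₃ ∩ connEvent ends a₃ b) +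
        2 * (prob (Function.update p e 0) (TEvent ends a₂ a₁ a₃) *
              prob (Function.update p e 0) (PDEvent ends a₁ a₂ a₃ ∩ connEvent ends a₂ b) -
            prob (Function.update p e 0) (PDEvent ends a₁ a₂ a₃) *
              prob (Function.update p e 0) (TEvent ends a₂ a₁ a₃ ∩ connEvent ends a₂ b)) := by
  unfold slackBm EQb3 EQ3 PDb
  rw [gap_eq_Q (Function.update p e 1), gap_eq_Q (Function.update p e 0)]
  unfold Qb
  -- the open pin: `PD` and `T` null, `T′ = Q`
  simp only [prob_one_PD_inter p hends a₂, prob_one_T_inter p hends a₂, prob_one_T'_inter p hends a₂,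
    prob_one_PD p hends a₂, prob_one_T p hends a₂, prob_one_T' p hends a₂]
  -- the open pin's `Q`, `Q ∩ bL`, `Q ∩ bH` in closed-pin masses
  rw [prob_one_Q_root_split p hends a₂, prob_one_Q_bL_root_split p hends a₂ b,
    prob_one_Q_bH_root_split p hends a₂ b]
  -- the closed pin's `Q`-masses split over the three worlds
  rw [Qsplit_univ (Function.update p e 0) ends a₁ a₂ a₃,
    Qsplit (Function.update p e 0) ends a₁ a₂ a₃ (connEvent ends a₁ b),
    Qsplit (Function.update p e 0) ends a₁ a₂ a₃ (connEvent ends a₂ b)]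
  ring

omit [Fintype V] in
/-- **`slackBm ≤ 2·df + 2·δ_bH`** at a root edge (the `P(PD, b ↔ a₃)` term is `≤ 0`). -/
theorem slackBm_root_le (p : E → R) (hp : IsProbVec p) (hends : ends e = s(a₁, a₃)) (a₂ b : V) :
    slackBm p ends a₁ a₂ a₃ b e ≤
      2 * (prob (Function.update p e 0) (avoidAll ends a₂ {a₁}) *
            (prob (Function.update p e 1) (avoidAll ends a₂ {a₁} ∩ connEvent ends a₁ b) -
              prob (Function.update p e 1) (avoidAll ends a₂ {a₁} ∩ connEvent ends a₂ b)) -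
          prob (Function.update p e 1) (avoidAll ends a₂ {a₁}) *
            (prob (Function.update p e 0) (avoidAll ends a₂ {a₁} ∩ connEvent ends a₁ b) -
              prob (Function.update p e 0) (avoidAll ends a₂ {a₁} ∩ connEvent ends a₂ b))) +
        2 * (prob (Function.update p e 0) (TEvent ends a₂ a₁ a₃) *
              prob (Function.update p e 0) (PDEvent ends a₁ a₂ a₃ ∩ connEvent ends a₂ b) -
            prob (Function.update p e 0) (PDEvent ends a₁ a₂ a₃) *
              prob (Function.update p e 0) (TEvent ends a₂ a₁ a₃ ∩ connEvent ends a₂ b)) := by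
  have hp₀ : IsProbVec (Function.update p e 0) := hp.update e le_rfl zero_le_one
  have hp₁ : IsProbVec (Function.update p e 1) := hp.update e zero_le_one le_rfl
  rw [slackBm_root_decomp p hends a₂ b]
  have h := mul_nonneg (prob_nonneg hp₁ (avoidAll ends a₂ {a₁}))
    (prob_nonneg hp₀ (PDEvent ends a₁ a₂ a₃ ∩ connEvent ends a₃ b))
  linarith [h]

omit [Fintype V] in
/-- **`0 ≤ slackBm` at a root edge iff `Q₁·P₀(PD, b ↔ a₃) ≤ df + δ_bH`** — the census-true sign of the
middle slack coefficient is a lower bound on the rise of `E_ν[σ_b]` across the root edge. -/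
theorem slackBm_nonneg_root_iff (p : E → R) (hends : ends e = s(a₁, a₃)) (a₂ b : V) :
    0 ≤ slackBm p ends a₁ a₂ a₃ b e ↔
      prob (Function.update p e 1) (avoidAll ends a₂ {a₁}) *
          prob (Function.update p e 0) (PDEvent ends a₁ a₂ a₃ ∩ connEvent ends a₃ b) ≤
        (prob (Function.update p e 0) (avoidAll ends a₂ {a₁}) *
            (prob (Function.update p e 1) (avoidAll ends a₂ {a₁} ∩ connEvent ends a₁ b) -
              prob (Function.update p e 1) (avoidAll ends a₂ {a₁} ∩ connEvent ends a₂ b)) -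
          prob (Function.update p e 1) (avoidAll ends a₂ {a₁}) *
            (prob (Function.update p e 0) (avoidAll ends a₂ {a₁} ∩ connEvent ends a₁ b) -
              prob (Function.update p e 0) (avoidAll ends a₂ {a₁} ∩ connEvent ends a₂ b))) +
        (prob (Function.update p e 0) (TEvent ends a₂ a₁ a₃) *
              prob (Function.update p e 0) (PDEvent ends a₁ a₂ a₃ ∩ connEvent ends a₂ b) -
            prob (Function.update p e 0) (PDEvent ends a₁ a₂ a₃) *
              prob (Function.update p e 0) (TEvent ends a₂ a₁ a₃ ∩ connEvent ends a₂ b)) := by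
  rw [slackBm_root_decomp p hends a₂ b]
  constructor <;> intro h <;> linarith [h]

omit [Fintype V] [DecidableEq V] in
/-- **`Q₀·H2` at a root edge decomposed**: `Q₀·H2 = 2·D₀·Q₀²·g₁ + Q₁²·Gc₀ + df·dg + Q₀·c·slackBm`
with `g₁`, `df`, `dg` the three signed pieces of `A3RootEdge` (`RootEdgeBern.B1_eq_root` /
`B2_eq_root`) and `c = covUm`. -/
theorem Q0_mul_H2_root (p : E → R) (hends : ends e = s(a₁, a₃)) (o a₂ b : V) :
    prob (Function.update p e 0) (avoidAll ends a₂ {a₁}) * H2 p ends o a₁ a₂ a₃ b e =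
      2 * prob (Function.update p e 0) (PDEvent ends a₁ a₂ a₃) *
          prob (Function.update p e 0) (avoidAll ends a₂ {a₁}) ^ 2 *
          (-2 * (prob (Function.update p e 1) (avoidAll ends a₂ {a₁}) *
            (prob (Function.update p e 1)
                (avoidAll ends a₂ {a₁} ∩ (connEvent ends a₂ o ∩ connEvent ends a₁ b)) -
              prob (Function.update p e 1)
                (avoidAll ends a₂ {a₁} ∩ (connEvent ends a₂ o ∩ connEvent ends a₂ b))) -
          (prob (Function.update p e 1) (avoidAll ends a₂ {a₁} ∩ connEvent ends a₁ b) -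
              prob (Function.update p e 1) (avoidAll ends a₂ {a₁} ∩ connEvent ends a₂ b)) *
            prob (Function.update p e 1) (avoidAll ends a₂ {a₁} ∩ connEvent ends a₂ o))) +
        prob (Function.update p e 1) (avoidAll ends a₂ {a₁}) ^ 2 *
          Gc (Function.update p e 0) ends o a₁ a₂ a₃ b +
        (prob (Function.update p e 0) (avoidAll ends a₂ {a₁}) *
            (prob (Function.update p e 1) (avoidAll ends a₂ {a₁} ∩ connEvent ends a₁ b) -
              prob (Function.update p e 1) (avoidAll ends a₂ {a₁} ∩ connEvent ends a₂ b)) -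
          prob (Function.update p e 1) (avoidAll ends a₂ {a₁}) *
            (prob (Function.update p e 0) (avoidAll ends a₂ {a₁} ∩ connEvent ends a₁ b) -
              prob (Function.update p e 0) (avoidAll ends a₂ {a₁} ∩ connEvent ends a₂ b))) *
        (Do (Function.update p e 0) ends o a₁ a₂ a₃ *
              prob (Function.update p e 0) (avoidAll ends a₂ {a₁}) *
              prob (Function.update p e 1) (avoidAll ends a₂ {a₁}) -
            2 * prob (Function.update p e 1) (avoidAll ends a₂ {a₁} ∩ connEvent ends a₂ o) *
              prob (Function.update p e 0) (PDEvent ends a₁ a₂ a₃) *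
              prob (Function.update p e 0) (avoidAll ends a₂ {a₁}) -
            DEF (Function.update p e 0) ends o a₁ a₂ a₃ *
              prob (Function.update p e 1) (avoidAll ends a₂ {a₁})) +
        prob (Function.update p e 0) (avoidAll ends a₂ {a₁}) * covUm p ends o a₁ a₂ a₃ e *
          slackBm p ends a₁ a₂ a₃ b e := by
  have hH2 := H2_eq_root p hends o a₂ b
  rw [← covUm_eq_root p hends o a₂] at hH2
  have hB1 := B1_eq_root p hends o a₂ b
  have hB2 := B2_eq_root p hends o a₂ b
  rw [hH2, hB2]
  linear_combination hB1
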